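import Literature.MathematicalPhysics.QuantumLattice.PseudospinBondPairTriplet
import Literature.MathematicalPhysics.QuantumLattice.FermionOperatorsEtaSu2Proofs
import Literature.MathematicalPhysics.QuantumLattice.FermionOperatorsEtaSpinProofs
import Literature.MathematicalPhysics.QuantumLattice.Su2Multiplet
import Literature.MathematicalPhysics.QuantumLattice.FinDimSpectrumSectorGibbsLimit
import Literature.MathematicalPhysics.QuantumLattice.HubbardWave0LiebProofs
import Literature.MathematicalPhysics.QuantumLattice.PairFieldMomentum
import Literature.MathematicalPhysics.QuantumLattice.SectorEigenvalueContinuation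
import HarnessLib

/-!
# Pseudospin bound on the pair field of `η`-lowest-weight sector ground states, I: general graphs

Soloist `solo-HubbardSuperconductivity-informed` (family `hubbard`), necessary condition N15 of
the sharpest-statement paper, §10: a NEW finite-volume inequality constraining every putative
witness of `Summit.HubbardSuperconductivity` (`Literature.Hubbard.DWaveSuperconductivityHubbard`).
It is not a route to the summit; it is a kernel-checked constraint on what a proof must produce.
Part II (`SoloInformedPseudospinPairBoundTorus`) specialises to the torus, the `d`-wave pair field
of `PairCorrelations`, and the summit's own format.

## Statement

Let `Λ` be finite, `ε : Λ → ℤˣ` a sign, `η_ε^±`, `η^z = ½(N̂ - |Λ|)` Yang's pseudospin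
(`etaRaise`, `etaLower`, `etaZ`). For a finite family of bonds `b i = (x_i, y_i)` joining opposite
signs (`ε_{y_i} = -ε_{x_i}`) with weights `w_i ∈ ℂ` put
`Δ_w = Σ_i w_i d_{x_i y_i}` (singlet bond pair annihilator, `bondPairAnn`) and
`J_w = Σ_i w_i ε_{x_i} j_{x_i y_i}` (staggered spin-summed bond current, `bondCurrent`).

* `re_norm_sq_M_mulVec_le` — abstract `su(2)` lemma: for a triple `(P, M, Z)` and `φ` with
  `M(Mφ) = 0`, `Z(Mφ) = m·Mφ`, `m ≤ 0`: `‖Mφ‖² ≤ (-2m)‖φ‖²` (norm identity + Cauchy–Schwarz).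
* `eta_isSu2Triple` — Yang's `(η^+, η^-, η^z)` is an `IsSu2Triple`.
* `re_norm_sq_weightedPair_le_of_etaLower_eq_zero` — **kinematic triplet bound**: if `ψ` is an
  `N`-particle vector with `η_ε^- ψ = 0` (an `η`-LOWEST-WEIGHT vector) and `N ≤ |Λ| + 2`, then
  `‖Δ_w ψ‖² ≤ ((|Λ| + 2 - N)/4) · ‖J_w ψ‖²`.
  Proof: Zhang's triplet relation `[η^-, J_w] = -2 Δ_w`, `[η^-, Δ_w] = 0`
  (`PseudospinBondPairTriplet`) gives `η^-(J_w ψ) = -2 Δ_w ψ` and `(η^-)²(J_w ψ) = 0`; the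
  `su(2)` norm identity `‖η^+ χ‖² = ‖η^- χ‖² - 2m‖χ‖²` on the weight-`m` vector `χ = η^- J_w ψ`
  (`m = (N - 2 - |Λ|)/2`) and Cauchy–Schwarz `‖χ‖² = ⟨J_w ψ, η^+ χ⟩ ≤ ‖J_w ψ‖ ‖η^+ χ‖` close it.
  The bound is an equality for `η`-singlets at half filling (`N = |Λ|`, factor `½`: Wigner–Eckart).
* `etaLower_mulVec_eq_zero_of_isGroundStateInSector` — **lowest weight from a sector gap**: on a
  graph `G` bipartite for `ε`, a ground state `ψ` of `H = hamiltonian G t U` in the sector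
  `(N, S^z = S)` satisfies `η_ε^- ψ = 0` as soon as
  `E₀(N, S) - U < E₀(N - 2, S)` (`E₀ = minEnergyOn ∘ szSector`), because `η^-` lowers the energy
  by exactly `U` (Yang, `[H, η^+] = U η^+`) and maps the sector `(N, S)` into `(N - 2, S)`.
* `re_norm_sq_weightedPair_le_of_isGroundStateInSector` — the two combined.

## Sources

S.-C. Zhang, *Pseudospin symmetry and new collective modes of the Hubbard model*, PRL **65**
(1990) 120 [cite: Zhang1990]; R. S. Markiewicz, M. T. Vaughn, J. Phys. Chem. Solids **59** (1998)
1737, p. 3 (arXiv:cond-mat/9709137) [cite: MarkiewiczVaughn1998, p. 3]; C. N. Yang, PRL **63**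
(1989) 2144, eq. (6) [cite: Yang1989, eq. (6)]; C. N. Yang, S.-C. Zhang, Mod. Phys. Lett. B **4**
(1990) 759, Theorem 1 [cite: YangZhang1990, Theorem 1]; H. Tasaki, *Physics and Mathematics of
Quantum Many-Body Systems* (2020) §2.4 (the `su(2)` norm identity). Nearest prior art for the MOVE
(Wigner–Eckart selection rules of the `η`-pairing SU(2) applied to correlation functions of the
components of a local `η`-multiplet, for the `η`-SINGLET half-filled ground state): F. H. L. Essler,
H. Frahm, F. Göhmann, A. Klümper, V. E. Korepin, *The One-Dimensional Hubbard Model* (CUP 2005),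
§9.3, pp. 313–314 [cite: EsslerEtAl2005, §9.3]. The inequality for `η`-LOWEST-WEIGHT states away
from half filling, with the explicit weight factor `(|Λ| + 2 - N)/4`, and its use as a constraint on
`d`-wave pair order appear to be new (soloist claim C32; searches recorded in the soloist's
SEARCHLOG.md).
-/

namespace Summit.HubbardSuperconductivity.HubbardSuperconductivity.Theorems

open Matrix Finset Literature.Probability.LatticeModels Literature.MathematicalPhysics.QuantumLattice
  Literature.MathematicalPhysics.QuantumLattice.HubbardWave0
open scoped ComplexOrder

/-! ### An abstract `su(2)` lemma: the norm of a lowest component through the middle one -/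

section Su2

variable {ι : Type*} [Fintype ι]

/-- Cauchy–Schwarz in `dotProduct` form (real parts): `(Re u⋆·v)² ≤ (u⋆·u)(v⋆·v)`. [folklore] -/
theorem re_star_dotProduct_sq_le (u v : ι → ℂ) :
    (star u ⬝ᵥ v).re ^ 2 ≤ (star u ⬝ᵥ u).re * (star v ⬝ᵥ v).re := by
  have h := norm_inner_le_norm (𝕜 := ℂ) (WithLp.toLp 2 u : EuclideanSpace ℂ ι) (WithLp.toLp 2 v)
  rw [EuclideanSpace.inner_toLp_toLp, dotProduct_comm] at h
  have hn : ∀ w : ι → ℂ, ‖(WithLp.toLp 2 w : EuclideanSpace ℂ ι)‖ ^ 2 = (star w ⬝ᵥ w).re := by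
    intro w
    rw [@norm_sq_eq_re_inner ℂ, EuclideanSpace.inner_toLp_toLp, dotProduct_comm]
    rfl
  have h1 : |(star u ⬝ᵥ v).re| ≤
      ‖(WithLp.toLp 2 u : EuclideanSpace ℂ ι)‖ * ‖(WithLp.toLp 2 v : EuclideanSpace ℂ ι)‖ :=
    (Complex.abs_re_le_norm _).trans h
  have h2 := pow_le_pow_left₀ (abs_nonneg _) h1 2
  rwa [sq_abs, mul_pow, hn u, hn v] at h2

variable {P M Z : Matrix ι ι ℂ}

/-- **Lowest component through the middle one.** For an `su(2)` triple `(P, M, Z)` (`M = Pᴴ` the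
lowering operator) and a vector `φ` such that `χ = M φ` has weight `m ≤ 0` and `M χ = 0`
(so `χ` is a lowest-weight component reached in one lowering step):
`‖M φ‖² ≤ (-2m) ‖φ‖²`. From the norm identity `‖P χ‖² = ‖M χ‖² - 2m ‖χ‖²` (Tasaki 2020 §2.4)
and Cauchy–Schwarz `‖χ‖² = ⟨φ, P χ⟩ ≤ ‖φ‖ ‖P χ‖`. [folklore] -/
theorem re_norm_sq_M_mulVec_le (h : IsSu2Triple P M Z) {φ : ι → ℂ} {m : ℝ}
    (hw : Z *ᵥ (M *ᵥ φ) = (m : ℂ) • (M *ᵥ φ)) (hMM : M *ᵥ (M *ᵥ φ) = 0) (hm : m ≤ 0) :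
    (star (M *ᵥ φ) ⬝ᵥ (M *ᵥ φ)).re ≤ (-2 * m) * (star φ ⬝ᵥ φ).re := by
  set χ := M *ᵥ φ with hχdef
  have hA : star (P *ᵥ χ) ⬝ᵥ (P *ᵥ χ) = (-2 * (m : ℂ)) * (star χ ⬝ᵥ χ) := by
    have key := h.norm_M_eq hw
    rw [hMM, star_zero, zero_dotProduct] at key
    linear_combination (-1 : ℂ) * key
  have hB : star χ ⬝ᵥ χ = star φ ⬝ᵥ (P *ᵥ χ) := h.star_M_mulVec_dotProduct φ χ
  have hAre : (star (P *ᵥ χ) ⬝ᵥ (P *ᵥ χ)).re = (-2 * m) * (star χ ⬝ᵥ χ).re := by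
    rw [hA, show (-2 * (m : ℂ)) = ((-2 * m : ℝ) : ℂ) by push_cast; ring, Complex.re_ofReal_mul]
  have hcs := re_star_dotProduct_sq_le φ (P *ᵥ χ)
  rw [← hB, hAre] at hcs
  have ha := EigenvalueContinuation.re_star_dotProduct_self_nonneg χ
  have hb := EigenvalueContinuation.re_star_dotProduct_self_nonneg φ
  have hk : 0 ≤ -2 * m := by linarith
  by_cases ha0 : (star χ ⬝ᵥ χ).re = 0
  · rw [ha0]; exact mul_nonneg hk hb
  · have hapos : 0 < (star χ ⬝ᵥ χ).re := lt_of_le_of_ne ha (Ne.symm ha0)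
    have h3 : (star χ ⬝ᵥ χ).re * (star χ ⬝ᵥ χ).re ≤
        (-2 * m) * (star φ ⬝ᵥ φ).re * (star χ ⬝ᵥ χ).re := by nlinarith [hcs]
    exact le_of_mul_le_mul_right h3 hapos

end Su2

/-! ### Yang's pseudospin as an `su(2)` triple; particle number bookkeeping -/

section Hubbard

variable {Λ : Type*} [LinearOrder Λ] [Fintype Λ]

/-- Yang's pseudospin `(η_ε^+, η_ε^-, η^z)` is an `su(2)` triple of matrices for every sign `ε`
(`η^z = ½(N̂ - |Λ|)` is Hermitian, `[η^+, η^-] = 2η^z`, `[η^z, η^+] = η^+`).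
Yang–Zhang, Mod. Phys. Lett. B 4 (1990) 759, Theorem 1. [cite: YangZhang1990, Theorem 1] -/
theorem eta_isSu2Triple (ε : Λ → ℤˣ) :
    IsSu2Triple (etaRaise ε) (etaLower ε) (etaZ : Matrix (Finset (Orb Λ)) (Finset (Orb Λ)) ℂ) := by
  have hZ : (etaZ : Matrix (Finset (Orb Λ)) (Finset (Orb Λ)) ℂ)ᴴ = etaZ := by
    have hN := (totalNumber_isHermitian (Λ := Λ)).eq
    simp [etaZ, conjTranspose_smul, conjTranspose_sub, hN]
  exact IsSu2Triple.mk' rfl hZ (etaRaise_commutator_etaLower ε) (etaZ_commutator_etaRaise ε)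

/-- A vector is an `N`-particle vector iff it is an `N̂`-eigenvector with eigenvalue `N`.
Tasaki (2020) §9.2. [folklore] -/
theorem isNParticle_iff_totalNumber_mulVec {N : ℕ} {ψ : Fock (Orb Λ)} :
    IsNParticle N ψ ↔ totalNumber *ᵥ ψ = (N : ℂ) • ψ := by
  refine ⟨fun h => ?_, fun h => ?_⟩
  · funext s
    rw [totalNumber_mulVec_apply, Pi.smul_apply, smul_eq_mul]
    by_cases hs : s.card = N
    · rw [hs]
    · rw [h s hs, mul_zero, mul_zero]
  · intro s hs
    have h1 := congrFun h s
    rw [totalNumber_mulVec_apply, Pi.smul_apply, smul_eq_mul] at h1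
    have h2 : ((s.card : ℂ) - N) * ψ s = 0 := by rw [sub_mul, h1, sub_self]
    rcases mul_eq_zero.1 h2 with h3 | h3
    · exact absurd (by exact_mod_cast sub_eq_zero.1 h3 : s.card = N) hs
    · exact h3

/-- `η^z φ = ((n - |Λ|)/2) φ` on an `N̂`-eigenvector `N̂ φ = n φ`. Yang–Zhang (1990), eq. (5). [folklore] -/
theorem etaZ_mulVec_of_totalNumber_mulVec {φ : Fock (Orb Λ)} {n : ℂ}
    (hφ : totalNumber *ᵥ φ = n • φ) :
    etaZ *ᵥ φ = ((n - Fintype.card Λ) / 2) • φ := by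
  rw [etaZ, smul_mulVec, sub_mulVec, hφ, smul_mulVec, one_mulVec, ← sub_smul, smul_smul]
  congr 1
  ring

/-- `[N̂, η_ε^-] = -2 η_ε^-` (adjoint of `[N̂, η^+] = 2η^+`). Yang (1989). [folklore] -/
theorem totalNumber_commutator_etaLower (ε : Λ → ℤˣ) :
    totalNumber * etaLower ε - etaLower ε * totalNumber =
      (-2 : ℂ) • etaLower ε := by
  have h := congrArg conjTranspose (totalNumber_commutator_etaRaise_holds (Λ := Λ) ε)
  rw [conjTranspose_sub, conjTranspose_mul, conjTranspose_mul, conjTranspose_smul,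
    (totalNumber_isHermitian (Λ := Λ)).eq] at h
  rw [etaLower]
  calc totalNumber * (etaRaise ε)ᴴ - (etaRaise ε)ᴴ * totalNumber
      = -((etaRaise ε)ᴴ * totalNumber - totalNumber * (etaRaise ε)ᴴ) := by
        abel
    _ = -(star (2 : ℂ) • (etaRaise ε)ᴴ) := by rw [h]
    _ = (-2 : ℂ) • (etaRaise ε)ᴴ := by rw [star_ofNat, neg_smul]

/-- `[N̂, d_{xy}] = -2 d_{xy}` for the singlet bond pair annihilator. [folklore] -/
theorem totalNumber_commutator_bondPairAnn (x y : Λ) :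
    totalNumber * bondPairAnn x y - bondPairAnn x y * totalNumber =
      (-2 : ℂ) • bondPairAnn x y := by
  rw [bondPairAnn]
  exact commutator_sub_eq_smul totalNumber (annihilation (orb x 0) * annihilation (orb y 1))
    (annihilation (orb x 1) * annihilation (orb y 0)) (-2)
    (totalNumber_commutator_annihilation_mul_annihilation (orb x 0) (orb y 1))
    (totalNumber_commutator_annihilation_mul_annihilation (orb x 1) (orb y 0))

/-- `[N̂, Δ_w] = -2 Δ_w` for every weighted bond pair field. [folklore] -/
theorem totalNumber_commutator_weightedPair {β : Type*} (s : Finset β) (b : β → Λ × Λ) (w : β → ℂ) :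
    totalNumber * (∑ i ∈ s, w i • bondPairAnn (b i).1 (b i).2) -
        (∑ i ∈ s, w i • bondPairAnn (b i).1 (b i).2) * totalNumber =
      (-2 : ℂ) • ∑ i ∈ s, w i • bondPairAnn (b i).1 (b i).2 :=
  commutator_sum_eq_smul s _ _ _ fun _ _ =>
    commutator_smul_eq_smul _ _ _ _ (totalNumber_commutator_bondPairAnn _ _)

/-- If `[N̂, X] = c X` and `N̂ ψ = n ψ` then `N̂ (X ψ) = (n + c) X ψ`. [folklore] -/
theorem totalNumber_mulVec_mulVec_of_commutator {X : Matrix (Finset (Orb Λ)) (Finset (Orb Λ)) ℂ}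
    {c n : ℂ} (hX : totalNumber * X - X * totalNumber = c • X)
    {ψ : Fock (Orb Λ)} (hψ : totalNumber *ᵥ ψ = n • ψ) :
    totalNumber *ᵥ (X *ᵥ ψ) = (n + c) • (X *ᵥ ψ) := by
  have h1 : totalNumber * X = X * totalNumber + c • X :=
    eq_add_of_sub_eq' hX
  rw [mulVec_mulVec, h1, add_mulVec, ← mulVec_mulVec, hψ, mulVec_smul, smul_mulVec, add_smul]

/-! ### The kinematic triplet bound -/

/-- **Kinematic pseudospin triplet bound** (soloist claim C32, kinematic half). For a sign `ε`,
a finite bond family `b i = (x_i, y_i)` with `ε_{y_i} = -ε_{x_i}` and weights `w_i`, and an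
`N`-particle vector `ψ` with `η_ε^- ψ = 0` and `N ≤ |Λ| + 2`:
`‖Δ_w ψ‖² ≤ ((|Λ| + 2 - N)/4) ‖J_w ψ‖²`, where `Δ_w = Σ w_i d_{x_i y_i}` and
`J_w = Σ w_i ε_{x_i} j_{x_i y_i}`. Built on Zhang's triplet relation (PRL 65 (1990) 120) and the
`su(2)` norm identity. [cite: Zhang1990] -/
theorem re_norm_sq_weightedPair_le_of_etaLower_eq_zero (ε : Λ → ℤˣ) {β : Type*} (s : Finset β)
    (b : β → Λ × Λ) (w : β → ℂ) (hb : ∀ i ∈ s, ε (b i).2 = -ε (b i).1) {N : ℕ} {ψ : Fock (Orb Λ)}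
    (hN : IsNParticle N ψ) (hNc : N ≤ Fintype.card Λ + 2) (hη : etaLower ε *ᵥ ψ = 0) :
    (star ((∑ i ∈ s, w i • bondPairAnn (b i).1 (b i).2) *ᵥ ψ) ⬝ᵥ
        ((∑ i ∈ s, w i • bondPairAnn (b i).1 (b i).2) *ᵥ ψ)).re ≤
      ((Fintype.card Λ + 2 - N : ℝ) / 4) *
        (star ((∑ i ∈ s, (w i * ((ε (b i).1 : ℤ) : ℂ)) • bondCurrent (b i).1 (b i).2) *ᵥ ψ) ⬝ᵥ
          ((∑ i ∈ s, (w i * ((ε (b i).1 : ℤ) : ℂ)) • bondCurrent (b i).1 (b i).2) *ᵥ ψ)).re := by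
  set Δ := ∑ i ∈ s, w i • bondPairAnn (b i).1 (b i).2 with hΔ
  set J := ∑ i ∈ s, (w i * ((ε (b i).1 : ℤ) : ℂ)) • bondCurrent (b i).1 (b i).2 with hJ
  set φ := J *ᵥ ψ with hφ
  -- the triplet relation applied to `ψ`: `η^- (J ψ) = -2 Δ ψ`
  have hχ : etaLower ε *ᵥ φ = (-2 : ℂ) • (Δ *ᵥ ψ) := by
    have h := etaLower_commutator_weightedCurrent s b w ε hb
    have h' : etaLower ε * J = J * etaLower ε + (-2 : ℂ) • Δ := eq_add_of_sub_eq' h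
    rw [hφ, mulVec_mulVec, h', add_mulVec, ← mulVec_mulVec, hη, mulVec_zero, zero_add,
      smul_mulVec]
  -- `(η^-)² (J ψ) = 0`
  have hMM : etaLower ε *ᵥ (etaLower ε *ᵥ φ) = 0 := by
    rw [hχ, mulVec_smul, mulVec_mulVec, (etaLower_commute_weightedPair s b w ε).eq, ← mulVec_mulVec,
      hη, mulVec_zero, smul_zero]
  -- weight of `χ = η^- J ψ = -2 Δ ψ`: `N̂ χ = (N - 2) χ`, `η^z χ = ((N - 2 - |Λ|)/2) χ`
  have hNψ := isNParticle_iff_totalNumber_mulVec.1 hN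
  have hNχ : totalNumber *ᵥ (etaLower ε *ᵥ φ) =
      ((N : ℂ) + (-2 : ℂ)) • (etaLower ε *ᵥ φ) := by
    rw [hχ, mulVec_smul, totalNumber_mulVec_mulVec_of_commutator
      (totalNumber_commutator_weightedPair s b w) hNψ, smul_comm]
  have hw : etaZ *ᵥ (etaLower ε *ᵥ φ) =
      (((N - 2 - Fintype.card Λ : ℝ) / 2 : ℝ) : ℂ) • (etaLower ε *ᵥ φ) := by
    rw [etaZ_mulVec_of_totalNumber_mulVec hNχ]
    congr 1
    push_cast
    ring
  have hm : (N - 2 - Fintype.card Λ : ℝ) / 2 ≤ 0 := by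
    have : (N : ℝ) ≤ Fintype.card Λ + 2 := by exact_mod_cast hNc
    linarith
  have key := re_norm_sq_M_mulVec_le (eta_isSu2Triple ε) hw hMM hm
  -- `‖χ‖² = 4 ‖Δ ψ‖²`
  have h4 : (star (etaLower ε *ᵥ φ) ⬝ᵥ (etaLower ε *ᵥ φ)).re =
      4 * (star (Δ *ᵥ ψ) ⬝ᵥ (Δ *ᵥ ψ)).re := by
    rw [hχ, star_smul, smul_dotProduct, dotProduct_smul, smul_smul, smul_eq_mul]
    rw [show star (-2 : ℂ) * (-2 : ℂ) = ((4 : ℝ) : ℂ) by simp; norm_num, Complex.re_ofReal_mul]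
  rw [h4] at key
  have hcoef : -2 * ((N - 2 - Fintype.card Λ : ℝ) / 2) = (Fintype.card Λ + 2 - N : ℝ) := by ring
  rw [hcoef] at key
  linarith

/-! ### Lowest weight from a two-hole sector gap -/

/-- `η_ε^-` commutes with `S^z` (adjoint of `[η^+, S^z] = 0`). Yang–Zhang (1990). [folklore] -/
theorem etaLower_commute_spinZ (ε : Λ → ℤˣ) :
    Commute (etaLower ε) (spinZ : Matrix (Finset (Orb Λ)) (Finset (Orb Λ)) ℂ) := by
  have h := congrArg conjTranspose (etaRaise_commute_spinZ ε).eq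
  rw [conjTranspose_mul, conjTranspose_mul, spinZ_isHermitian.eq] at h
  rw [Commute, SemiconjBy, etaLower]
  exact h.symm

/-- `[H, η_ε^-] = -U η_ε^-` on an `ε`-bipartite graph (adjoint of Yang's `[H, η^+] = U η^+`).
Yang, PRL 63 (1989) 2144, eq. (6). [cite: Yang1989, eq. (6)] -/
theorem hamiltonian_commutator_etaLower (G : SimpleGraph Λ) [DecidableRel G.Adj] (ε : Λ → ℤˣ)
    (hε : ∀ x y, G.Adj x y → ε x = -ε y) (t U : ℝ) :
    hamiltonian G t U * etaLower ε - etaLower ε * hamiltonian G t U = (-(U : ℂ)) • etaLower ε := by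
  have h := congrArg conjTranspose (hamiltonian_commutator_etaRaise G ε hε t U)
  rw [conjTranspose_sub, conjTranspose_mul, conjTranspose_mul, conjTranspose_smul,
    (LiebThm1.hamiltonian_isHermitian G t U).eq] at h
  rw [etaLower]
  calc hamiltonian G t U * (etaRaise ε)ᴴ - (etaRaise ε)ᴴ * hamiltonian G t U
      = -((etaRaise ε)ᴴ * hamiltonian G t U - hamiltonian G t U * (etaRaise ε)ᴴ) := by abel
    _ = -(star (U : ℂ) • (etaRaise ε)ᴴ) := by rw [h]
    _ = (-(U : ℂ)) • (etaRaise ε)ᴴ := by rw [Complex.star_def, Complex.conj_ofReal, neg_smul]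

/-- **`η`-lowest weight from a two-hole sector gap** (soloist claim C32, spectral half). On a
graph `G` bipartite for the sign `ε`, let `ψ` be a ground state of `H = hamiltonian G t U` in the
sector `(N, S^z = S)`, `2 ≤ N`. If `E₀(N, S) - U < E₀(N - 2, S)` then `η_ε^- ψ = 0`: otherwise
`η^- ψ ≠ 0` would be an eigenvector of `H` in the sector `(N - 2, S)` with energy `E₀(N, S) - U`
(Yang: `H η^- = η^- (H - U)`), below that sector's minimum. [cite: Yang1989, eq. (6)] -/
theorem etaLower_mulVec_eq_zero_of_isGroundStateInSector (G : SimpleGraph Λ) [DecidableRel G.Adj]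
    (ε : Λ → ℤˣ) (hε : ∀ x y, G.Adj x y → ε x = -ε y) (t U : ℝ) {N : ℕ} {S : ℝ}
    {ψ : Fock (Orb Λ)} (hGS : IsGroundStateInSector (hamiltonian G t U) N S ψ) (hN : 2 ≤ N)
    (hgap : (hamiltonian G t U).minEnergyOn (szSector N S) - U <
      (hamiltonian G t U).minEnergyOn (szSector (N - 2) S)) :
    etaLower ε *ᵥ ψ = 0 := by
  obtain ⟨hmem, -, hH⟩ := hGS
  rw [mem_szSector_iff] at hmem
  obtain ⟨hNP, hSz⟩ := hmem
  set H := hamiltonian G t U with hHdef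
  set E₀ := H.minEnergyOn (szSector N S) with hE₀
  set χ := etaLower ε *ᵥ ψ with hχdef
  -- `H χ = (E₀ - U) χ`
  have hHχ : H *ᵥ χ = ((E₀ - U : ℝ) : ℂ) • χ := by
    have h1 : H * etaLower ε = etaLower ε * H + (-(U : ℂ)) • etaLower ε :=
      eq_add_of_sub_eq' (hamiltonian_commutator_etaLower G ε hε t U)
    rw [hχdef, mulVec_mulVec, h1, add_mulVec, ← mulVec_mulVec, hH, mulVec_smul, smul_mulVec,
      ← add_smul]
    congr 1
    push_cast
    ring
  -- `χ ∈ szSector (N - 2) S`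
  have hNχ : totalNumber *ᵥ χ = ((N - 2 : ℕ) : ℂ) • χ := by
    rw [hχdef, totalNumber_mulVec_mulVec_of_commutator (totalNumber_commutator_etaLower ε)
      (isNParticle_iff_totalNumber_mulVec.1 hNP)]
    congr 1
    push_cast [hN]
    ring
  have hχN : IsNParticle (N - 2) χ := isNParticle_iff_totalNumber_mulVec.2 hNχ
  have hχS : spinZ *ᵥ χ = (S : ℂ) • χ := by
    rw [hχdef, mulVec_mulVec, ← (etaLower_commute_spinZ ε).eq, ← mulVec_mulVec, hSz, mulVec_smul]
  have hχmem : χ ∈ szSector (N - 2) S := (mem_szSector_iff _ _ _).2 ⟨hχN, hχS⟩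
  by_contra hχ0
  obtain ⟨c, -, hc1⟩ := exists_smul_unit hχ0
  have hmem' : c • χ ∈ szSector (N - 2) S := Submodule.smul_mem _ c hχmem
  have hle := minEnergyOn_le_rayleigh_of_mem (LiebThm1.hamiltonian_isHermitian G t U) (szSector (N - 2) S)
    hmem' hc1
  have hray : star (c • χ) ⬝ᵥ H *ᵥ (c • χ) = ((E₀ - U : ℝ) : ℂ) := by
    rw [mulVec_smul, hHχ, smul_comm, dotProduct_smul, hc1, smul_eq_mul, mul_one]
  rw [← hHdef, hray, Complex.ofReal_re] at hle
  linarith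

/-- **Pseudospin triplet bound for sector ground states** (soloist claim C32): on an `ε`-bipartite
graph, a ground state `ψ` of `hamiltonian G t U` in the sector `(N, S^z = S)` with
`2 ≤ N ≤ |Λ| + 2` and two-hole sector gap `E₀(N, S) - U < E₀(N - 2, S)` obeys, for every bond
family `b` joining opposite signs and all weights `w`,
`‖Δ_w ψ‖² ≤ ((|Λ| + 2 - N)/4) ‖J_w ψ‖²`. [cite: Zhang1990] -/
theorem re_norm_sq_weightedPair_le_of_isGroundStateInSector (G : SimpleGraph Λ)
    [DecidableRel G.Adj] (ε : Λ → ℤˣ) (hε : ∀ x y, G.Adj x y → ε x = -ε y) (t U : ℝ) {N : ℕ}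
    {S : ℝ} {ψ : Fock (Orb Λ)} (hGS : IsGroundStateInSector (hamiltonian G t U) N S ψ)
    (hN : 2 ≤ N) (hNc : N ≤ Fintype.card Λ + 2)
    (hgap : (hamiltonian G t U).minEnergyOn (szSector N S) - U <
      (hamiltonian G t U).minEnergyOn (szSector (N - 2) S))
    {β : Type*} (s : Finset β) (b : β → Λ × Λ) (w : β → ℂ)
    (hb : ∀ i ∈ s, ε (b i).2 = -ε (b i).1) :
    (star ((∑ i ∈ s, w i • bondPairAnn (b i).1 (b i).2) *ᵥ ψ) ⬝ᵥ
        ((∑ i ∈ s, w i • bondPairAnn (b i).1 (b i).2) *ᵥ ψ)).re ≤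
      ((Fintype.card Λ + 2 - N : ℝ) / 4) *
        (star ((∑ i ∈ s, (w i * ((ε (b i).1 : ℤ) : ℂ)) • bondCurrent (b i).1 (b i).2) *ᵥ ψ) ⬝ᵥ
          ((∑ i ∈ s, (w i * ((ε (b i).1 : ℤ) : ℂ)) • bondCurrent (b i).1 (b i).2) *ᵥ ψ)).re :=
  re_norm_sq_weightedPair_le_of_etaLower_eq_zero ε s b w hb ((mem_szSector_iff _ _ _).1 hGS.1).1
    hNc (etaLower_mulVec_eq_zero_of_isGroundStateInSector G ε hε t U hGS hN hgap)

end Hubbard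

end Summit.HubbardSuperconductivity.HubbardSuperconductivity.Theorems
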